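import Summits.Langlands.Langlands.Theses.RationalPeriodQuarter
import Summits.Langlands.Langlands.Theorems.RationalPeriodQuarterHeckeTransport
import Summits.Langlands.Langlands.Theorems.RationalPeriodQuarterRationalFormsInjectivity

/-!
# `RationalPeriodQuarter.HeckeFieldOfCruxes` (stmt-Langlands-10432) — proved

The glue item `HeckeFieldOfCruxes` of route `RationalPeriodQuarter` (support r9, but the consumed binder `h₅` of the
route's certified `closes … := h₇ (h₆ (h₅ h₁ h₂ h₃ h₄))`):

    RationalPeriodClassesQuarter → PeriodClassNontrivialQuarter → SemiAnalyticRigidity →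
      HeckePreservesRationalPeriods → HeckeFieldQuarter,

proved by the decomp-langlands lens-1-g38 seed node `HeckeFieldOfCruxesSplit`
(`HeckeFieldOfCruxes ⟸ RationalFormsInjectivity ∧ HeckeTransportQuarter`, cut at the interface statement
"ℚ-linearly independent rational-period quarter cusp forms are ℂ-linearly independent"), with both children landed:
`rationalFormsInjectivity_statement` (child A: cocycle linearity, the projection lemma `PR_ℂ = PR_ℚ ⊗ ℂ`, and the
cruxes h₂, h₃) and `heckeTransportQuarter_statement` (child B: Hecke transport on the ℚ-structure plus the proved
`RationalEigencharacterLemma`).  With this file the open binders of the route's `closes` are exactly the four cruxes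
`RationalPeriodClassesQuarter`, `PeriodClassNontrivialQuarter`, `HeckePreservesRationalPeriods`,
`NoRationalPeriodClass` (h₃ `SemiAnalyticRigidity` is proved: `rationalPeriodQuarter_semiAnalyticRigidity`).
-/

set_option linter.dupNamespace false

namespace Summit.Langlands.Langlands.Theorems

/-- `RationalPeriodQuarter.HeckeFieldOfCruxes` (stmt-Langlands-10432). -/
theorem rationalPeriodQuarter_heckeFieldOfCruxes :
    Summit.Langlands.Langlands.Theses.RationalPeriodQuarter.HeckeFieldOfCruxes :=
  fun h₁ h₂ h₃ h₄ => heckeTransportQuarter_statement h₁ h₄ (rationalFormsInjectivity_statement h₂ h₃)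

end Summit.Langlands.Langlands.Theorems
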